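import Summits.BirchSwinnertonDyer.BirchSwinnertonDyer.Theorems.GoldfeldAllTwistsTwoConverseTwinQuarterTraceRelationsE
import Summits.BirchSwinnertonDyer.BirchSwinnertonDyer.Theorems.GoldfeldAllTwistsTwoConverseTwinQuarterTracePartnerEHeightModFour
import HarnessLib

set_option linter.dupNamespace false -- namespace `…BirchSwinnertonDyer.BirchSwinnertonDyer…` is the cell's (D-0017 nested layout)
set_option autoImplicit false

/-!
# TRANCHE C7-2 (cosmetic discharge, generic form): file E3, the `χ_e` half-trace relation over `K[1]` (`…TwinQuarterTraceRelationsE`, `exists_halfTrace_relation_e_modFour`) — `hp8 : p % 8 = 5` relaxed to `hp4 : p % 4 = 1`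

Cell `bsd-goldfeld`, seat `bsd-goldfeld-s1p-c3x` (gen 12); planner RULING (cccxxxviii) (2), TRANCHE C7-2; memo `HOME/C7-HORIZON.md` §1 (audit: `hp8` is
COSMETIC in the declarations below — consumed only through `prime_ne_two_ne_seven_of_mod_eight_five`, `arith_negEightTwoPrimes`,
`splitsCompletelyInH_one_of_beta`, `lValue_posTwist_mul_sqrt_of_beta` and cosmetic callees). `--supports stmt-BirchSwinnertonDyer-20044` as a HELPER.
Theses-free; theorems only; no definition, no `sorry`, no new fact; binders EXACTLY as the originals. The proofs are the landed ones VERBATIM with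
`hp8 ↦ hp4` (scripted twin generator `ROUTE-S1PLUS/c7-c3xg12/modfour2.py`, section/attribute structure of the source file preserved). Uses E1's `rankOne_negTwoPrimesTwist_of_thm14_modFour`.
HONEST FRAMING: CONDITIONAL on the named printed facts exactly as the originals; no case of K12₂″ / twin″ decided; BSD is not proved by any of this. -/


noncomputable section

open scoped Classical IntermediateField

open WeierstrassCurve Literature.NumberTheory.EllipticCurves Literature.NumberTheory.EllipticCurves.ModularForms
  Literature.NumberTheory.EllipticCurves.CoatesLiTianZhai2015

namespace Summit.BirchSwinnertonDyer.BirchSwinnertonDyer.Theorems.GoldfeldGoodTwists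

/-! ## §1 The abstract combination -/

section Abstract

variable {M : Type*} [AddCommGroup M]

end Abstract

-- the cell's point-group world over the ring class fields; file-local
attribute [local instance 2000] Classical.propDecidable

/-! ## §2 The `χ_e` collinearity in `X₀(49)(K[1])` -/

section RelationE

variable {K : Type} [Field K] [NumberField K] {L : Type} [Field L] [NumberField L] [Algebra K L]
  [FiniteDimensional K L] [IsGalois K L]

/-- **`M₁•P_e = (2m₁)•Y_e + t₁`, `M₁, m₁` odd.** Setting of THEOREM A⁗ (type β, `hNo4`): `r_e ∈ L`, `r_e² = −qp`; `P_e` the `χ_e` genus sum of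
`y₁`; `Y_e` the partner point `y_{ℚ(√−qp)}` — a `χ_e`-point of infinite order negated by the `σ` with `σ r_e = −r_e` (P2e-2); the height ratio
`ρ₂ĥ(P_e) = 4ρ₁ĥ(Y_e)` (P2e-1). Granted CLTZ Thm 1.4 (`h14`). [cite: CoatesLiTianZhai2015, Thm. 1.4 and (2.8)] [cite: SilvermanAEC2009, Thm. VIII.9.3] -/
theorem exists_halfTrace_relation_e_modFour (h14 : thm14_rankOne_twist) (hK : IsImaginaryQuadratic K) {q p : ℕ} (hq : q.Prime)
    (h3 : 3 < q) (hq4 : q % 4 = 3) (hq7 : jacobiSym q 7 = -1) [Fact p.Prime] (hp4 : p % 4 = 1)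
    (hβ : ∃ x : ZMod p, x ^ 4 = -7) (hNo4 : LiLiuTian2024.NoIdealClassOfOrderFour (-((q : ℤ) * p)))
    (hdK : NumberField.discr K = -(8 * (q : ℤ) * p)) {re : L} (hre : re ^ 2 = algebraMap K L (-((q : K) * p)))
    (y₁ : (cm7.baseChange L).toAffine.Point) (Ye : (cm7.baseChange L).toAffine.Point) (hYent : ¬ IsOfFinAddOrder Ye)
    (hYefix : ∀ σ : L ≃ₐ[K] L, σ re = re → Affine.Point.map (σ : L →ₐ[K] L) Ye = Ye)
    (hYeneg : ∀ σ : L ≃ₐ[K] L, σ re = -re → Affine.Point.map (σ : L →ₐ[K] L) Ye = -Ye)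
    {ρ₁ ρ₂ : ℤ} (hρ₁ : Odd ρ₁) (hρ₂ : Odd ρ₂)
    (hHR : (ρ₂ : ℝ) * Affine.Point.canonicalHeight
        (∑ σ : L ≃ₐ[K] L, (if σ re = re then (1 : ℤ) else -1) • Affine.Point.map (σ : L →ₐ[K] L) y₁) =
      4 * ρ₁ * Affine.Point.canonicalHeight Ye) :
    ∃ (M₁ m₁ : ℤ) (t₁ : (cm7.baseChange L).toAffine.Point), Odd M₁ ∧ Odd m₁ ∧ IsOfFinAddOrder t₁ ∧
      M₁ • (∑ σ : L ≃ₐ[K] L, (if σ re = re then (1 : ℤ) else -1) • Affine.Point.map (σ : L →ₐ[K] L) y₁) = (2 * m₁) • Ye + t₁ := by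
  haveI : (cm7.baseChange L).IsElliptic := by rw [WeierstrassCurve.baseChange]; infer_instance
  have hp : p.Prime := Fact.out
  have hqp0 : ((q : ℚ) * p) ≠ 0 := by have := hq.ne_zero; have := hp.ne_zero; positivity
  have hd0 : (-((q : ℚ) * p)) ≠ 0 := neg_ne_zero.mpr hqp0
  have hqpL : ((q : L) * p) ≠ 0 := by have := hq.ne_zero; have := hp.ne_zero; positivity
  have hr0 : re ≠ 0 := by
    intro h; rw [h, zero_pow two_ne_zero, map_neg, map_mul, map_natCast, map_natCast] at hre
    exact hqpL (neg_eq_zero.mp hre.symm)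
  set Pχ : (cm7.baseChange L).toAffine.Point :=
    ∑ σ : L ≃ₐ[K] L, (if σ re = re then (1 : ℤ) else -1) • Affine.Point.map (σ : L →ₐ[K] L) y₁ with hPχ
  -- the descent data: `d = −qp` is not a square in `K`; rank `V₁(ℚ) = 1`; `V₁^{(d_K)}(ℚ)` torsion
  have hd : ¬ IsSquare (algebraMap ℚ K (-((q : ℚ) * p))) := by
    rw [← neg_mul]; exact not_isSquare_neg_qp_of_discr_negEightTwoPrimes hK hq hp hdK
  have hr' : re ^ 2 = algebraMap K L (algebraMap ℚ K (-((q : ℚ) * p))) := by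
    rw [hre, map_neg (algebraMap ℚ K), map_mul (algebraMap ℚ K), map_natCast, map_natCast]
  haveI := isElliptic_twist_one_cm7 hd0
  have hV : ((cm7.quadraticTwist (-((q : ℚ) * p))).quadraticTwist 1).mordellWeilRank = 1 := by
    haveI := cm7.isElliptic_quadraticTwist hd0
    obtain ⟨W', hE', hmin', C, hC⟩ := exists_isGloballyMinimal_smul_eq_quadraticTwist cm7 hd0
    have h1 : W'.mordellWeilRank = 1 := (rankOne_negTwoPrimesTwist_of_thm14_modFour h14 hq h3 hq4 hq7 hp hp4 hβ hNo4 W' ⟨C, hC⟩).2.1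
    have h2 : (cm7.quadraticTwist (-((q : ℚ) * p))).mordellWeilRank = 1 := by
      have h := mordellWeilRank_variableChange_holds W' C
      unfold mordellWeilRank_variableChange at h
      rw [← hC, h, h1]
    rw [mordellWeilRank_congr (quadraticTwist_quadraticTwist_one_cm7 _), h2]
  have hT : ∀ R : ((cm7.quadraticTwist (-((q : ℚ) * p))).quadraticTwist (NumberField.discr K : ℚ)).toAffine.Point,
      IsOfFinAddOrder R := by
    intro R
    have hc1 : (-((q : ℚ) * p)) = -(((q * p : ℕ) : ℚ)) := by push_cast; ring
    have hc2 : (NumberField.discr K : ℚ) = -(8 * (((q * p : ℕ) : ℚ))) := by rw [hdK]; push_cast; ring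
    have e := Affine.Point.congrEquiv (show (cm7.quadraticTwist (-((q : ℚ) * p))).quadraticTwist (NumberField.discr K : ℚ) =
      (cm7.quadraticTwist (-(((q * p : ℕ) : ℚ)))).quadraticTwist (-(8 * (((q * p : ℕ) : ℚ)))) by rw [hc1, hc2])
    have h := isOfFinAddOrder_point_twist_negPrime_negEight (l := q * p) (mul_ne_zero hq.ne_zero hp.ne_zero) (e R)
    simpa using e.symm.toAddMonoidHom.isOfFinAddOrder h
  have hstep := exists_two_zsmul_sub_of_rank_one_of_twist_torsion hK hd0 hV hT
  obtain ⟨hPfix, hPneg⟩ := isChiPoint_twistedSum (K := K) hre hr0 y₁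
  obtain ⟨a, b, ha, hab⟩ := exists_zsmul_sub_zsmul_isOfFinAddOrder_of_isChiPoint_of_step hd hr' hstep Pχ Ye
    hPfix hPneg hYefix hYeneg hYent
  have hY0 : Affine.Point.canonicalHeight Ye ≠ 0 := fun h0 ↦
    hYent ((Summit.BirchSwinnertonDyer.Uniform.U2.HeegnerHeight.canonicalHeight_eq_zero_iff' Ye).mp h0)
  obtain ⟨M₁, m, t, hM, hm, ht, h4⟩ := exists_odd_zsmul_eq_two_mul_zsmul_add_of_height
    (A := (cm7.baseChange L).toAffine.Point) Affine.Point.canonicalHeight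
    (fun n x ↦ Affine.Point.canonicalHeight_zsmul_holds n x) hY0 ha hab hρ₁ hρ₂ hHR
  exact ⟨M₁, m, t, hM, hm, ht, h4⟩

end RelationE

/-! ## §3 The genus relation of the partner field `F = ℚ(√−qp)` in `X₀(49)(F[1])` -/

section RelationPrime

variable {F : Type} [Field F] [NumberField F] {L : Type} [Field L] [NumberField L] [Algebra F L]
  [FiniteDimensional F L] [IsGalois F L]

end RelationPrime

end Summit.BirchSwinnertonDyer.BirchSwinnertonDyer.Theorems.GoldfeldGoodTwists

end
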